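import Mathlib.Analysis.CStarAlgebra.Matrix
import Summits.QuantumFields.QCD.Theorems.ExtinctionBuildsQCD.Negative.ChiralInertia

/-!
# Weyl's inequality in counting form (support for stub `stub_indexAPSubPerLeWindow`)
(line `block-away-the-sign`, crux `Summit.QuantumFields.QCD.Theses.SpectralDefectExtinction.ExtinctionBuildsQCD`,
item stmt-QuantumFields-18064)

Finite-dimensional linear algebra over `ℂ`, Mathlib plus the landed inertia toolkit
`Theorems/ExtinctionBuildsQCD/Negative/ChiralInertia.lean`.  For Hermitian matrices `A`, `B` of the same size:

* `card_filter_lt_neg_le` — counting stability (min–max): if `|Re v†(B − A)v| ≤ δ Σ‖v‖²` then `B` has at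
  least as many eigenvalues with `σλ < 0` as `A` has with `σλ < −δ` (`σ = ±1`);
* `abs_negCount_sub_le_windowCount_of_form` / `…_of_opNorm_le` — **Weyl window budget**:
  `|n₋(B) − n₋(A)| ≤ #{eigenvalues λ of A with |λ| ≤ w}` whenever `|Re v†(B − A)v| ≤ w Σ‖v‖²`, in particular
  whenever `‖B − A‖ ≤ w` in the `ℓ²` operator norm (`n₋` = number of roots of the characteristic polynomial
  with negative real part, with multiplicity).

The lemmas are adapted (with attribution comments) from the crux disprovers' work files
`Cruxes/WindowExtinction/Disproof.lean` and `Cruxes/ExtinctionBuildsQCD/DisproofBase.lean`.  Landed copies of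
five of them (`countP_roots_eq_card_filter`, `card_filter_lt_neg_le`, `countP_neg_add_pos_add_zero`,
`card_filter_le_add`, `re_star_dotProduct_self`) exist in `Theorems/WindowExtinction/Negative/SpectralFlowLocal`,
`Theorems/ExtinctionBuildsQCD/Negative/WeylWindow` and `Theorems/WegnerEstimate/Negative/PositivityReduction`,
modules which transitively import files bound to the pre-restatement text of the route's cruxes and which this
line therefore must not import; the copies here are `private` (file-local plumbing), the exported statements
being `finrank_le_card_filter` and the two window budgets.

Reference: R. Bhatia, *Matrix Analysis* (1997), Cor. III.2.6 (Weyl's monotonicity / perturbation theorem);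
Horn–Johnson, *Matrix Analysis*, §4.3.
-/

noncomputable section

namespace Summit.QuantumFields.QCD.Cruxes.ExtinctionBuildsQCD.BlockAwayTheSign

open scoped BigOperators Classical Matrix
open Matrix

namespace IndexAPSubPer

/-! ## §1 Weyl's inequality in counting form, from a form bound (abstract Hermitian matrices) -/

section Weyl

variable {n : Type*} [Fintype n]

-- adapted from Cruxes/ExtinctionBuildsQCD/DisproofBase.lean:sum_norm_sq_pos
/-- A non-zero vector has positive `Σ ‖v i‖²`. -/
theorem sum_norm_sq_pos {v : n → ℂ} (hv : v ≠ 0) : 0 < ∑ i, ‖v i‖ ^ 2 := by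
  obtain ⟨i, hi⟩ : ∃ i, v i ≠ 0 := by
    by_contra h
    push Not at h
    exact hv (funext h)
  exact Finset.sum_pos' (fun j _ => by positivity) ⟨i, Finset.mem_univ _, by positivity⟩

-- adapted from Cruxes/ExtinctionBuildsQCD/DisproofBase.lean:re_star_dotProduct_self
/-- `Re (v† v) = Σ ‖v i‖²`. -/
private theorem re_star_dotProduct_self (v : n → ℂ) : (star v ⬝ᵥ v).re = ∑ i, ‖v i‖ ^ 2 := by
  rw [dotProduct, Complex.re_sum]
  refine Finset.sum_congr rfl fun i _ => ?_
  rw [Pi.star_apply, Complex.star_def, ← Complex.normSq_eq_conj_mul_self, Complex.ofReal_re,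
    Complex.normSq_eq_norm_sq]

variable [DecidableEq n]

open scoped Matrix.Norms.L2Operator in
-- adapted from Cruxes/ExtinctionBuildsQCD/DisproofBase.lean:norm_star_dotProduct_mulVec_le
/-- Cauchy–Schwarz with the `ℓ² → ℓ²` operator norm: `‖v† A v‖ ≤ ‖A‖ · Σ‖v i‖²`. -/
theorem norm_star_dotProduct_mulVec_le (A : Matrix n n ℂ) (v : n → ℂ) :
    ‖star v ⬝ᵥ (A *ᵥ v)‖ ≤ ‖A‖ * ∑ i, ‖v i‖ ^ 2 := by
  have hinner : ∀ a b : n → ℂ,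
      star a ⬝ᵥ b = inner ℂ (WithLp.toLp 2 a : EuclideanSpace ℂ n) (WithLp.toLp 2 b) :=
    fun a b => by rw [EuclideanSpace.inner_eq_star_dotProduct, dotProduct_comm]
  set x : EuclideanSpace ℂ n := WithLp.toLp 2 v with hx
  have hx2 : ‖x‖ ^ 2 = ∑ i, ‖v i‖ ^ 2 := by
    rw [← re_star_dotProduct_self, hinner, ← inner_self_eq_norm_sq (𝕜 := ℂ)]
    rfl
  calc ‖star v ⬝ᵥ (A *ᵥ v)‖
      = ‖inner ℂ x (Matrix.toEuclideanCLM (n := n) (𝕜 := ℂ) A x)‖ := by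
        rw [hinner, hx, Matrix.toEuclideanCLM_toLp]
    _ ≤ ‖x‖ * ‖Matrix.toEuclideanCLM (n := n) (𝕜 := ℂ) A x‖ := norm_inner_le_norm _ _
    _ ≤ ‖x‖ * (‖Matrix.toEuclideanCLM (n := n) (𝕜 := ℂ) A‖ * ‖x‖) := by
        gcongr
        exact ContinuousLinearMap.le_opNorm _ _
    _ = ‖A‖ * ∑ i, ‖v i‖ ^ 2 := by rw [← hx2, Matrix.cstar_norm_def]; ring

-- adapted from Cruxes/WindowExtinction/Disproof.lean:countP_roots_eq_card_filter
/-- For a Hermitian matrix the root count with a real predicate is the eigenvalue count. -/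
private theorem countP_roots_eq_card_filter {A : Matrix n n ℂ} (hA : A.IsHermitian) (p : ℝ → Prop)
    [DecidablePred p] :
    A.charpoly.roots.countP (fun z => p z.re) =
      (Finset.univ.filter fun i => p (hA.eigenvalues i)).card := by
  rw [hA.roots_charpoly_eq_eigenvalues, Multiset.countP_map, Finset.card_def, Finset.filter_val]
  congr 1

-- adapted from Cruxes/WindowExtinction/Disproof.lean:sum_norm_sq_star_unitary_mulVec
/-- Parseval for a unitary: `Σ ‖(U† v)_j‖² = Σ ‖v_j‖²`. -/
theorem sum_norm_sq_star_unitary_mulVec (U : Matrix.unitaryGroup n ℂ) (v : n → ℂ) :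
    ∑ j, ‖((star (U : Matrix n n ℂ)) *ᵥ v) j‖ ^ 2 = ∑ j, ‖v j‖ ^ 2 := by
  have h : star ((star (U : Matrix n n ℂ)) *ᵥ v) ⬝ᵥ ((star (U : Matrix n n ℂ)) *ᵥ v) =
      star v ⬝ᵥ v := by
    rw [star_mulVec, star_eq_conjTranspose, conjTranspose_conjTranspose, ← dotProduct_mulVec,
      mulVec_mulVec]
    have : (U : Matrix n n ℂ) * star (U : Matrix n n ℂ) = 1 := Unitary.coe_mul_star_self U
    rw [star_eq_conjTranspose] at this
    rw [this, one_mulVec]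
  have h2 := congrArg Complex.re h
  rw [re_star_dotProduct_self, re_star_dotProduct_self] at h2
  exact h2

-- adapted from Cruxes/WindowExtinction/Disproof.lean:re_star_dotProduct_mulVec_eq
/-- **Quadratic form in the eigenbasis**: `Re (v† A v) = Σ_j λ_j ‖(U† v)_j‖²`. -/
theorem re_star_dotProduct_mulVec_eq {A : Matrix n n ℂ} (hA : A.IsHermitian) (v : n → ℂ) :
    (star v ⬝ᵥ A *ᵥ v).re =
      ∑ j, hA.eigenvalues j * ‖((star (hA.eigenvectorUnitary : Matrix n n ℂ)) *ᵥ v) j‖ ^ 2 := by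
  rw [star_eq_conjTranspose]
  exact Summit.QuantumFields.QCD.Theorems.ExtinctionBuildsQCD.Negative.re_form_eq_sum_eigenvalues hA v

-- adapted from Cruxes/WindowExtinction/Disproof.lean:finrank_le_card_filter
/-- **Min–max, lower half (inertia bound).** If `σ · Re (v† A v) < 0` on a subspace `W` (off `0`),
`σ = ±1`, then `A` has at least `dim W` eigenvalues `λ` with `σ λ < 0`. -/
theorem finrank_le_card_filter {A : Matrix n n ℂ} (hA : A.IsHermitian) (σ : ℝ)
    (W : Submodule ℂ (n → ℂ)) (hW : ∀ v ∈ W, v ≠ 0 → σ * (star v ⬝ᵥ A *ᵥ v).re < 0) :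
    Module.finrank ℂ W ≤ (Finset.univ.filter fun i => σ * hA.eigenvalues i < 0).card := by
  by_contra hlt
  rw [not_le] at hlt
  set U : Matrix n n ℂ := (hA.eigenvectorUnitary : Matrix n n ℂ) with hU
  let Neg := {i // σ * hA.eigenvalues i < 0}
  let Φ : W →ₗ[ℂ] (Neg → ℂ) :=
    (LinearMap.pi fun j : Neg => LinearMap.proj (R := ℂ) (φ := fun _ : n => ℂ) j.1) ∘ₗ
      (star U).mulVecLin ∘ₗ W.subtype
  have hdim : Module.finrank ℂ (Neg → ℂ) < Module.finrank ℂ W := by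
    rw [Module.finrank_fintype_fun_eq_card, Fintype.card_subtype]
    exact hlt
  obtain ⟨⟨v, hvW⟩, hvker, hv0⟩ :=
    Submodule.exists_mem_ne_zero_of_ne_bot (LinearMap.ker_ne_bot_of_finrank_lt (f := Φ) hdim)
  have hv0' : v ≠ 0 := fun h => hv0 (by simp [h])
  have hcoord : ∀ j, σ * hA.eigenvalues j < 0 → ((star U) *ᵥ v) j = 0 := by
    intro j hj
    have := congrFun (LinearMap.mem_ker.1 hvker) ⟨j, hj⟩
    simpa [Φ] using this
  have hq := re_star_dotProduct_mulVec_eq hA v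
  have hnonneg : 0 ≤ σ * (star v ⬝ᵥ A *ᵥ v).re := by
    rw [hq, Finset.mul_sum]
    refine Finset.sum_nonneg fun j _ => ?_
    by_cases hj : σ * hA.eigenvalues j < 0
    · rw [hcoord j hj]; simp
    · rw [not_lt] at hj
      have : σ * (hA.eigenvalues j * ‖(star U *ᵥ v) j‖ ^ 2) =
          (σ * hA.eigenvalues j) * ‖(star U *ᵥ v) j‖ ^ 2 := by ring
      rw [this]
      exact mul_nonneg hj (by positivity)
  exact absurd (hW v hvW hv0') (not_lt.2 hnonneg)

-- adapted from Cruxes/WindowExtinction/Disproof.lean:card_filter_lt_neg_le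
/-- **Counting stability (Weyl's inequality in counting form, with a sign `σ = ±1`).** Let `A`, `B`
be Hermitian with `|Re v†(B − A)v| ≤ δ Σ‖v‖²`. Then `B` has at least as many eigenvalues with
`σλ < 0` as `A` has eigenvalues with `σλ < −δ`. -/
private theorem card_filter_lt_neg_le {A B : Matrix n n ℂ} (hA : A.IsHermitian) (hB : B.IsHermitian)
    {σ δ : ℝ} (hσ : σ = 1 ∨ σ = -1)
    (hE : ∀ v : n → ℂ, |(star v ⬝ᵥ (B - A) *ᵥ v).re| ≤ δ * ∑ i, ‖v i‖ ^ 2) :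
    (Finset.univ.filter fun i => σ * hA.eigenvalues i < -δ).card ≤
      (Finset.univ.filter fun i => σ * hB.eigenvalues i < 0).card := by
  set U : Matrix n n ℂ := (hA.eigenvectorUnitary : Matrix n n ℂ) with hU
  let I := {i // σ * hA.eigenvalues i < -δ}
  let J := {i // ¬ σ * hA.eigenvalues i < -δ}
  let Φ : (n → ℂ) →ₗ[ℂ] (J → ℂ) :=
    (LinearMap.pi fun j : J => LinearMap.proj (R := ℂ) (φ := fun _ : n => ℂ) j.1) ∘ₗ
      (star U).mulVecLin
  let W : Submodule ℂ (n → ℂ) := LinearMap.ker Φ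
  have hWmem : ∀ v ∈ W, ∀ j, ¬ σ * hA.eigenvalues j < -δ → ((star U) *ᵥ v) j = 0 := by
    intro v hv j hj
    have := congrFun (LinearMap.mem_ker.1 hv) ⟨j, hj⟩
    simpa [Φ] using this
  have hWdim : Fintype.card I ≤ Module.finrank ℂ W := by
    show Fintype.card I ≤ Module.finrank ℂ (LinearMap.ker Φ)
    have h1 := Φ.finrank_range_add_finrank_ker
    have h2 : Module.finrank ℂ (LinearMap.range Φ) ≤ Fintype.card J := by
      calc Module.finrank ℂ (LinearMap.range Φ) ≤ Module.finrank ℂ (J → ℂ) :=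
            Submodule.finrank_le _
        _ = Fintype.card J := Module.finrank_fintype_fun_eq_card ℂ
    have h3 : Module.finrank ℂ (n → ℂ) = Fintype.card n := Module.finrank_fintype_fun_eq_card ℂ
    have h4 : Fintype.card I + Fintype.card J = Fintype.card n := by
      rw [Fintype.card_subtype_compl, Nat.add_sub_cancel' (Fintype.card_subtype_le _)]
    omega
  have hW : ∀ v ∈ W, v ≠ 0 → σ * (star v ⬝ᵥ B *ᵥ v).re < 0 := by
    intro v hv hv0
    set w := (star U) *ᵥ v with hw
    have hS := sum_norm_sq_star_unitary_mulVec hA.eigenvectorUnitary v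
    rw [← hU, ← hw] at hS
    have hSpos : 0 < ∑ j, ‖w j‖ ^ 2 := by rw [hS]; exact sum_norm_sq_pos hv0
    have hqA : σ * (star v ⬝ᵥ A *ᵥ v).re < -δ * ∑ j, ‖v j‖ ^ 2 := by
      rw [re_star_dotProduct_mulVec_eq hA v, ← hU, ← hw, Finset.mul_sum, ← hS, Finset.mul_sum]
      have hle : ∀ j ∈ Finset.univ, σ * (hA.eigenvalues j * ‖w j‖ ^ 2) ≤ -δ * ‖w j‖ ^ 2 := by
        intro j _
        by_cases hj : σ * hA.eigenvalues j < -δ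
        · have : σ * (hA.eigenvalues j * ‖w j‖ ^ 2) = (σ * hA.eigenvalues j) * ‖w j‖ ^ 2 := by
            ring
          rw [this]
          exact mul_le_mul_of_nonneg_right hj.le (by positivity)
        · have h0 : w j = 0 := by rw [hw]; exact hWmem v hv j hj
          rw [h0]; simp
      obtain ⟨j₀, hj₀⟩ : ∃ j, w j ≠ 0 :=
        Function.ne_iff.mp (fun h => by rw [h] at hSpos; simp at hSpos)
      have hj₀I : σ * hA.eigenvalues j₀ < -δ := by
        by_contra hc
        exact hj₀ (by rw [hw]; exact hWmem v hv j₀ hc)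
      have hlt : σ * (hA.eigenvalues j₀ * ‖w j₀‖ ^ 2) < -δ * ‖w j₀‖ ^ 2 := by
        have : σ * (hA.eigenvalues j₀ * ‖w j₀‖ ^ 2) = (σ * hA.eigenvalues j₀) * ‖w j₀‖ ^ 2 := by
          ring
        rw [this]
        exact mul_lt_mul_of_pos_right hj₀I (by positivity)
      exact Finset.sum_lt_sum hle ⟨j₀, Finset.mem_univ _, hlt⟩
    have hEv := hE v
    have hBv : (star v ⬝ᵥ B *ᵥ v).re =
        (star v ⬝ᵥ A *ᵥ v).re + (star v ⬝ᵥ (B - A) *ᵥ v).re := by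
      rw [sub_mulVec, dotProduct_sub, Complex.sub_re]; ring
    rw [hBv, mul_add]
    have : σ * (star v ⬝ᵥ (B - A) *ᵥ v).re ≤ δ * ∑ i, ‖v i‖ ^ 2 := by
      rcases hσ with rfl | rfl
      · rw [one_mul]; exact (le_abs_self _).trans hEv
      · rw [neg_one_mul]; exact (neg_le_abs _).trans hEv
    linarith
  calc (Finset.univ.filter fun i => σ * hA.eigenvalues i < -δ).card = Fintype.card I := by
        rw [Fintype.card_subtype]
    _ ≤ Module.finrank ℂ W := hWdim
    _ ≤ _ := finrank_le_card_filter hB σ W hW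

-- adapted from Cruxes/WindowExtinction/Disproof.lean:countP_neg_add_pos_add_zero
/-- Trichotomy of the eigenvalue counts of a Hermitian matrix: `ν + π + κ = n`. -/
private theorem countP_neg_add_pos_add_zero {A : Matrix n n ℂ} (hA : A.IsHermitian) :
    A.charpoly.roots.countP (fun z => z.re < 0) + A.charpoly.roots.countP (fun z => 0 < z.re) +
      A.charpoly.roots.countP (fun z => z.re = 0) = Fintype.card n := by
  rw [countP_roots_eq_card_filter hA (· < 0), countP_roots_eq_card_filter hA (0 < ·),
    countP_roots_eq_card_filter hA (· = 0)]
  have h1 := Finset.card_filter_add_card_filter_not (s := Finset.univ)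
    (fun i => hA.eigenvalues i < 0)
  have h2 : (Finset.univ.filter fun i => ¬ hA.eigenvalues i < 0) =
      (Finset.univ.filter fun i => 0 < hA.eigenvalues i) ∪
        (Finset.univ.filter fun i => hA.eigenvalues i = 0) := by
    ext i
    simp only [Finset.mem_filter, Finset.mem_univ, true_and, Finset.mem_union, not_lt]
    constructor
    · intro h
      rcases h.lt_or_eq with h | h
      · exact Or.inl h
      · exact Or.inr h.symm
    · rintro (h | h)
      · exact h.le
      · exact h.ge
  have h3 : Disjoint (Finset.univ.filter fun i => 0 < hA.eigenvalues i)
      (Finset.univ.filter fun i => hA.eigenvalues i = 0) := by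
    rw [Finset.disjoint_filter]
    intro i _ h1 h2
    rw [h2] at h1
    exact lt_irrefl _ h1
  rw [h2, Finset.card_union_of_disjoint h3, Finset.card_univ] at h1
  omega

omit [DecidableEq n] in
-- adapted from Cruxes/ExtinctionBuildsQCD/DisproofBase.lean:card_filter_le_add
/-- A filter contained in the union of two filters has at most the sum of their cardinalities. -/
private theorem card_filter_le_add {p q r : n → Prop} [DecidablePred p] [DecidablePred q]
    [DecidablePred r] (h : ∀ i, p i → q i ∨ r i) :
    (Finset.univ.filter p).card ≤ (Finset.univ.filter q).card + (Finset.univ.filter r).card := by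
  calc (Finset.univ.filter p).card ≤ (Finset.univ.filter q ∪ Finset.univ.filter r).card :=
        Finset.card_le_card fun i hi => by
          rw [Finset.mem_union, Finset.mem_filter, Finset.mem_filter]
          rcases h i (Finset.mem_filter.1 hi).2 with h | h
          · exact Or.inl ⟨Finset.mem_univ _, h⟩
          · exact Or.inr ⟨Finset.mem_univ _, h⟩
    _ ≤ _ := Finset.card_union_le _ _

-- adapted from Cruxes/ExtinctionBuildsQCD/DisproofBase.lean:abs_negCount_sub_le_windowCount_of_form
/-- **Weyl window budget from a form bound.** For Hermitian `A`, `B` with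
`|Re v†(B − A)v| ≤ w·Σ‖v‖²`: `|n₋(B) − n₋(A)| ≤ #{eigenvalues λ of A with |λ| ≤ w}` (roots of the
characteristic polynomial, with multiplicity). [Bhatia, Matrix Analysis, Cor. III.2.6] -/
theorem abs_negCount_sub_le_windowCount_of_form {A B : Matrix n n ℂ} (hA : A.IsHermitian)
    (hB : B.IsHermitian) {w : ℝ}
    (hE : ∀ v : n → ℂ, |(star v ⬝ᵥ (B - A) *ᵥ v).re| ≤ w * ∑ i, ‖v i‖ ^ 2) :
    |(B.charpoly.roots.countP (fun z => z.re < 0) : ℤ) -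
        A.charpoly.roots.countP (fun z => z.re < 0)| ≤
      A.charpoly.roots.countP (fun z => |z.re| ≤ w) := by
  have h1 : (Finset.univ.filter fun i => hA.eigenvalues i < -w).card ≤
      (Finset.univ.filter fun i => hB.eigenvalues i < 0).card := by
    convert card_filter_lt_neg_le hA hB (σ := 1) (δ := w) (Or.inl rfl) hE using 3 <;> simp
  have h2 : (Finset.univ.filter fun i => w < hA.eigenvalues i).card ≤
      (Finset.univ.filter fun i => 0 < hB.eigenvalues i).card := by
    convert card_filter_lt_neg_le hA hB (σ := -1) (δ := w) (Or.inr rfl) hE using 3 <;> simp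
  have htri := countP_neg_add_pos_add_zero hB
  rw [countP_roots_eq_card_filter hB (· < 0), countP_roots_eq_card_filter hB (0 < ·),
    countP_roots_eq_card_filter hB (· = 0)] at htri
  rw [countP_roots_eq_card_filter hA (· < 0), countP_roots_eq_card_filter hB (· < 0),
    countP_roots_eq_card_filter hA (fun x => |x| ≤ w)]
  have ha : (Finset.univ.filter fun i => hA.eigenvalues i < 0).card ≤
      (Finset.univ.filter fun i => hA.eigenvalues i < -w).card +
        (Finset.univ.filter fun i => |hA.eigenvalues i| ≤ w).card :=
    card_filter_le_add fun i hi => by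
      by_cases h : hA.eigenvalues i < -w
      · exact Or.inl h
      · exact Or.inr (abs_le.2 ⟨not_lt.1 h, by linarith⟩)
  have hb : (Finset.univ.filter fun i => ¬ w < hA.eigenvalues i).card ≤
      (Finset.univ.filter fun i => hA.eigenvalues i < 0).card +
        (Finset.univ.filter fun i => |hA.eigenvalues i| ≤ w).card :=
    card_filter_le_add fun i hi => by
      by_cases h : hA.eigenvalues i < 0
      · exact Or.inl h
      · exact Or.inr (abs_le.2 ⟨by linarith [not_lt.1 h], not_lt.1 hi⟩)
  have hN := Finset.card_filter_add_card_filter_not (s := (Finset.univ : Finset n))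
    (fun i => w < hA.eigenvalues i)
  have hNB := Finset.card_filter_add_card_filter_not (s := (Finset.univ : Finset n))
    (fun i => hB.eigenvalues i < 0)
  have hsub : (Finset.univ.filter fun i => 0 < hB.eigenvalues i).card ≤
      (Finset.univ.filter fun i => ¬ hB.eigenvalues i < 0).card :=
    Finset.card_le_card fun i hi => by
      rw [Finset.mem_filter] at hi ⊢
      exact ⟨hi.1, fun h => lt_asymm h hi.2⟩
  rw [abs_le]
  constructor <;> omega

open scoped Matrix.Norms.L2Operator in
/-- **Weyl's inequality in counting form, operator-norm version**: for Hermitian `A`, `B` with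
`‖B − A‖ ≤ w` (`ℓ²`-operator norm), `|n₋(B) − n₋(A)| ≤ #{eigenvalues λ of A with |λ| ≤ w}`.
[Bhatia, Matrix Analysis, Cor. III.2.6] -/
theorem abs_negCount_sub_le_windowCount_of_opNorm_le {A B : Matrix n n ℂ} (hA : A.IsHermitian)
    (hB : B.IsHermitian) {w : ℝ} (hw : ‖B - A‖ ≤ w) :
    |(B.charpoly.roots.countP (fun z => z.re < 0) : ℤ) -
        A.charpoly.roots.countP (fun z => z.re < 0)| ≤
      A.charpoly.roots.countP (fun z => |z.re| ≤ w) :=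
  abs_negCount_sub_le_windowCount_of_form hA hB fun v =>
    (Complex.abs_re_le_norm _).trans ((norm_star_dotProduct_mulVec_le (B - A) v).trans
      (mul_le_mul_of_nonneg_right hw (Finset.sum_nonneg fun i _ => by positivity)))

end Weyl

end IndexAPSubPer

/-- **Registered sub-goal `stub_indexAPSubPerLeWindowAux` (Weyl window budget from a form bound).** For Hermitian
`A`, `B` with `|Re v†(B − A)v| ≤ w·Σ‖v‖²`: `|n₋(B) − n₋(A)| ≤ #{eigenvalues λ of A with |λ| ≤ w}` (roots of the
characteristic polynomials with multiplicity). [Bhatia, Matrix Analysis, Cor. III.2.6] -/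
theorem stub_indexAPSubPerLeWindowAux : ∀ {n : Type} [Fintype n] [DecidableEq n] {A B : Matrix n n ℂ}, A.IsHermitian → B.IsHermitian → ∀ (w : ℝ), (∀ v : n → ℂ, |(star v ⬝ᵥ (B - A) *ᵥ v).re| ≤ w * ∑ i, ‖v i‖ ^ 2) → |((B.charpoly.roots.countP (fun z => z.re < 0) : ℕ) : ℤ) - ((A.charpoly.roots.countP (fun z => z.re < 0) : ℕ) : ℤ)| ≤ ((A.charpoly.roots.countP (fun z => |z.re| ≤ w) : ℕ) : ℤ) :=
  fun hA hB _ hE => IndexAPSubPer.abs_negCount_sub_le_windowCount_of_form hA hB hE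

end Summit.QuantumFields.QCD.Cruxes.ExtinctionBuildsQCD.BlockAwayTheSign

end
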